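import Mathlib
import HarnessLib
import Summits.ResolutionOfSingularities.ResolutionOfSingularities.Theorems.WildQuotientsWildQuotientResolutionS1aCoarseChart
import Summits.ResolutionOfSingularities.ResolutionOfSingularities.Theorems.WildQuotientsWildQuotientResolutionS1aVeroneseAtoms

/-!
# S1a — (G1a) VERONESE NORMALISATION PROVED: `CoarseChart.VeroneseNormalisation` holds

[OURS · L1 W4.5c · lead-1 g6] — NOT a statement of the manuscript; counted 0; AI-level work, weaker than expert
review. Crux stmt-ResolutionOfSingularities-17941 (`WildQuotients.CyclicQuotientFourfolds`), line `s1a-logminvertex`,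
stub `stub_localGame` (producer), residue **(G1a)** of idea-2ʼs H3-scheme (`h123/H3-SCHEME.md`; plan-1 RULING Q1/Q3
2026-08-27T21:04:06Z, LEAD1-GEN6-BRIEF A5a): the statement `CoarseChart.VeroneseNormalisation` of H4a
`…S1aCoarseChart` (p572350) — for a ring `B` graded by an additive commutative group `ι`, generated as a ring by its
degree-`0` part `𝒜 0` and finitely many elements (T2), and a HOMOGENEOUS weighted centre `(f, w)`, the degree-`0`
trace `K n = 𝒥ₙ ∩ 𝒜 0` of the weighted filtration has a Veronese degree `d > 0`: `K (d l) = (K d)^l` for all `l`.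

Proof (part 1 = `…S1aVeroneseAtoms`, p573342: kernel atoms by Dickson + the Veronese lemma for ideal filtrations).
* §3 Monomials `∏ⱼ genⱼ^{vⱼ}` in finitely many homogeneous generators `gen : M → B` (exponent vectors `v : M → ℕ`):
  multiplicative, homogeneous of degree `∑ vⱼ • δⱼ` (`SetLike.prod_pow_mem_graded`); the additive closures of the
  generator sets `genSet n` (`𝒜 0`-multiples of monomials of `ℕ`-weight `≥ n`) are multiplicative
  (`closure_mul_closure`), the closure of `genSet 0` is a subring containing `𝒜 0` and the generators — so it is all
  of `B` when these generate (`mem_closure_genSet_zero`) — and then the closure of `genSet n` is an ideal (`genIdeal`);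
  projecting to degree `0` (`GradedRing.proj 𝒜 0`, `DirectSum.coe_decompose_mul_of_left_mem_zero`) keeps only the
  KERNEL monomials (`mem_closure_kerGenSet`).
* §4 `traceFiltration_peel`: `K_n ≤ K_d · K_{n-d}` for `n ≥ N`, with `d, N` from the peeling lemma `exists_peel` of
  part 1 — an element of `K_n` lies in `𝒥ₙ ⊆ ⟨genSet n⟩`, is its own degree-`0` component, hence lies in
  `⟨kerGenSet n⟩`, and each kernel monomial of weight `≥ n ≥ N` splits as (kernel monomial of weight `d`) · (kernel
  monomial of weight `≥ n - d`) `∈ K_d · K_{n-d}`.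
* §5 `veroneseNormalisation`: instantiate with `M = S ⊕ Fin c`, `S` = the homogeneous components of the given ring
  generators (they generate together with `𝒜 0`, `DirectSum.sum_support_decompose`), `gen = (↑) ⊔ f`, weights
  `0 ⊔ w`; the centre monomials `f^α` are exactly the weighted monomials of [cite: Wlodarczyk2022, Lemma 2.1.9]
  (Literature `weightedMonomials`), and conclude by `idealFiltration_exists_veronese_of_peel`.
Axioms: `propext`, `Classical.choice`, `Quot.sound`.
-/

set_option linter.dupNamespace false

noncomputable section

open Literature.AlgebraicGeometry.Resolution

namespace Summit.ResolutionOfSingularities.ResolutionOfSingularities.Theorems.WildQuotientResolution.S1.Veronese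


/-! ## §3 Monomials in homogeneous generators -/

section Monomials

universe u v

variable {ι : Type v} [AddCommGroup ι] {B : Type u} [CommRing B]
  (𝒜 : ι → AddSubgroup B) {M : Type*} [Fintype M] (gen : M → B) (δM : M → ι) (wt : M → ℕ)

/-- Monomials are multiplicative in the exponent vector. [OURS · L1 W4.5c] -/
theorem mono_add (u v : M → ℕ) :
    ∏ j, gen j ^ (u + v) j = (∏ j, gen j ^ u j) * ∏ j, gen j ^ v j := by
  simp only [Pi.add_apply, pow_add, Finset.prod_mul_distrib]

/-- The monomial of a basis vector is the generator. [OURS · L1 W4.5c] -/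
theorem mono_single [DecidableEq M] (j₀ : M) : ∏ j, gen j ^ (Pi.single j₀ 1 : M → ℕ) j = gen j₀ := by
  rw [Finset.prod_eq_single j₀ (fun j _ hj => by rw [Pi.single_eq_of_ne hj, pow_zero])
    (fun h => absurd (Finset.mem_univ j₀) h), Pi.single_eq_same, pow_one]

/-- **The generator sets** `G n` of the additive group spanned by the `𝒜 0`-multiples of monomials of weight
`≥ n` (all monomials for `n = 0`). [OURS · L1 W4.5c] -/
def genSet (n : ℕ) : Set B :=
  {y | ∃ b ∈ 𝒜 0, ∃ v : M → ℕ, n ≤ ∑ j, v j * wt j ∧ y = b * ∏ j, gen j ^ v j}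

/-- The same with KERNEL exponent vectors (total degree `0`): these monomials lie in `𝒜 0`. [OURS · L1 W4.5c] -/
def kerGenSet (n : ℕ) : Set B :=
  {y | ∃ b ∈ 𝒜 0, ∃ v : M → ℕ, n ≤ ∑ j, v j * wt j ∧ ∑ j, v j • δM j = 0 ∧ y = b * ∏ j, gen j ^ v j}

variable {𝒜 gen wt}

/-- `b · (monomial of weight ≥ n) ∈ G n`. -/
theorem mul_mono_mem_genSet {n : ℕ} {b : B} (hb : b ∈ 𝒜 0) {v : M → ℕ} (hv : n ≤ ∑ j, v j * wt j) :
    b * ∏ j, gen j ^ v j ∈ genSet 𝒜 gen wt n :=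
  ⟨b, hb, v, hv, rfl⟩

variable [DecidableEq ι] [GradedRing 𝒜]

variable (𝒜 gen) in
/-- A monomial in homogeneous generators is homogeneous of the total degree of its exponent vector.
[OURS · L1 W4.5c] -/
theorem mono_mem_graded (hgen : ∀ j, gen j ∈ 𝒜 (δM j)) (v : M → ℕ) :
    ∏ j, gen j ^ v j ∈ 𝒜 (∑ j, v j • δM j) :=
  SetLike.prod_pow_mem_graded 𝒜 δM gen v fun j _ => hgen j

/-- The closures of the generator sets are multiplicative: `⟨G 0⟩ · ⟨G n⟩ ⊆ ⟨G n⟩`. [OURS · L1 W4.5c] -/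
theorem closure_mul_closure {n : ℕ} {z y : B} (hz : z ∈ AddSubgroup.closure (genSet 𝒜 gen wt 0))
    (hy : y ∈ AddSubgroup.closure (genSet 𝒜 gen wt n)) :
    z * y ∈ AddSubgroup.closure (genSet 𝒜 gen wt n) := by
  induction hy using AddSubgroup.closure_induction with
  | mem y hy =>
    obtain ⟨b, hb, v, hv, rfl⟩ := hy
    induction hz using AddSubgroup.closure_induction with
    | mem z hz =>
      obtain ⟨b', hb', u, -, rfl⟩ := hz
      have : b' * (∏ j, gen j ^ u j) * (b * ∏ j, gen j ^ v j) = (b' * b) * ∏ j, gen j ^ (u + v) j := by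
        rw [mono_add]; ring
      rw [this]
      refine AddSubgroup.subset_closure (mul_mono_mem_genSet ?_ ?_)
      · simpa using SetLike.mul_mem_graded hb' hb
      · rw [wdeg_add]; exact le_add_left hv
    | zero => rw [zero_mul]; exact zero_mem _
    | add z z' _ _ hz hz' => rw [add_mul]; exact add_mem hz hz'
    | neg z _ hz => rw [neg_mul]; exact neg_mem hz
  | zero => rw [mul_zero]; exact zero_mem _
  | add y y' _ _ hy hy' => rw [mul_add]; exact add_mem hy hy'
  | neg y _ hy => rw [mul_neg]; exact neg_mem hy

variable (𝒜 gen wt) in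
/-- The additive closure of `G 0` is a subring of `B`. [OURS · L1 W4.5c] -/
def genSubring : Subring B where
  carrier := AddSubgroup.closure (genSet 𝒜 gen wt 0)
  mul_mem' hz hy := closure_mul_closure hz hy
  one_mem' := by
    refine AddSubgroup.subset_closure ⟨1, SetLike.one_mem_graded 𝒜, 0, Nat.zero_le _, ?_⟩
    simp
  add_mem' hz hy := add_mem hz hy
  zero_mem' := zero_mem _
  neg_mem' hz := neg_mem hz

/-- If `𝒜 0` and the generators generate `B` as a ring, every element of `B` lies in the closure of `G 0`.
[OURS · L1 W4.5c] -/
theorem mem_closure_genSet_zero (hcl : Subring.closure (((𝒜 0 : AddSubgroup B) : Set B) ∪ Set.range gen) = ⊤)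
    (z : B) : z ∈ AddSubgroup.closure (genSet 𝒜 gen wt 0) := by
  classical
  have hle : Subring.closure (((𝒜 0 : AddSubgroup B) : Set B) ∪ Set.range gen) ≤ genSubring 𝒜 gen wt := by
    rw [Subring.closure_le]
    rintro x (hx | ⟨j, rfl⟩)
    · refine AddSubgroup.subset_closure ⟨x, hx, 0, Nat.zero_le _, ?_⟩
      simp
    · refine AddSubgroup.subset_closure ⟨1, SetLike.one_mem_graded 𝒜, Pi.single j 1, Nat.zero_le _, ?_⟩
      rw [mono_single, one_mul]
  have : z ∈ genSubring 𝒜 gen wt := hle (hcl ▸ Subring.mem_top z)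
  exact this

/-- The closure of `G n` is an ideal of `B` (given generation). [OURS · L1 W4.5c] -/
def genIdeal (hcl : Subring.closure (((𝒜 0 : AddSubgroup B) : Set B) ∪ Set.range gen) = ⊤) (n : ℕ) :
    Ideal B where
  carrier := AddSubgroup.closure (genSet 𝒜 gen wt n)
  add_mem' hz hy := add_mem hz hy
  zero_mem' := zero_mem _
  smul_mem' c y hy := by
    rw [smul_eq_mul]
    exact closure_mul_closure (mem_closure_genSet_zero hcl c) hy

/-- Projection to degree `0`: an element of `𝒜 0` in the closure of `G n` lies in the closure of the KERNEL
generator set. [OURS · L1 W4.5c] -/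
theorem mem_closure_kerGenSet (hgen : ∀ j, gen j ∈ 𝒜 (δM j)) {n : ℕ} {y : B}
    (hy : y ∈ AddSubgroup.closure (genSet 𝒜 gen wt n)) (hy0 : y ∈ 𝒜 0) :
    y ∈ AddSubgroup.closure (kerGenSet 𝒜 gen δM wt n) := by
  have key : ∀ y ∈ AddSubgroup.closure (genSet 𝒜 gen wt n),
      GradedRing.proj 𝒜 0 y ∈ AddSubgroup.closure (kerGenSet 𝒜 gen δM wt n) := by
    intro y hy
    induction hy using AddSubgroup.closure_induction with
    | mem y hy =>
      obtain ⟨b, hb, v, hv, rfl⟩ := hy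
      rw [GradedRing.proj_apply, DirectSum.coe_decompose_mul_of_left_mem_zero 𝒜 hb]
      by_cases hdeg : ∑ j, v j • δM j = 0
      · have hmem : ∏ j, gen j ^ v j ∈ 𝒜 0 := hdeg ▸ mono_mem_graded 𝒜 gen δM hgen v
        rw [DirectSum.decompose_of_mem_same 𝒜 hmem]
        exact AddSubgroup.subset_closure ⟨b, hb, v, hv, hdeg, rfl⟩
      · rw [DirectSum.decompose_of_mem_ne 𝒜 (mono_mem_graded 𝒜 gen δM hgen v) hdeg, mul_zero]
        exact zero_mem _
    | zero => rw [map_zero]; exact zero_mem _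
    | add z z' _ _ hz hz' => rw [map_add]; exact add_mem hz hz'
    | neg z _ hz => rw [map_neg]; exact neg_mem hz
  have := key y hy
  rwa [GradedRing.proj_apply, DirectSum.decompose_of_mem_same 𝒜 hy0] at this

end Monomials

/-! ## §4 The degree-0 trace: peeling and Veronese normalisation -/

section Trace

universe u v

variable {ι : Type v} [AddCommGroup ι] [DecidableEq ι] {B : Type u} [CommRing B]
  (𝒜 : ι → AddSubgroup B) [GradedRing 𝒜] {c : ℕ} (f : Fin c → B) (w : Fin c → ℕ)
  {M : Type*} [Fintype M] (gen : M → B) (δM : M → ι) (wt : M → ℕ)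

open CoarseChart

/-- **Peeling for the trace filtration.** Given homogeneous generators `gen` (with `𝒜 0` they generate `B`) and
weights `wt` such that every monomial lies in the weighted-filtration piece of its weight and every weighted
monomial of the centre is a monomial of at least that weight, there are `d > 0` and `N` with
`K_n ≤ K_d · K_{n-d}` for all `n ≥ N`, `K` the degree-`0` trace. [OURS · L1 W4.5c] -/
theorem traceFiltration_peel (hgen : ∀ j, gen j ∈ 𝒜 (δM j))
    (hcl : Subring.closure (((𝒜 0 : AddSubgroup B) : Set B) ∪ Set.range gen) = ⊤)
    (hmono : ∀ v : M → ℕ, ∏ j, gen j ^ v j ∈ (weightedFiltration f w).ideal (∑ j, v j * wt j))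
    (hwm : ∀ n, ∀ m ∈ weightedMonomials f w n, ∃ v : M → ℕ, n ≤ ∑ j, v j * wt j ∧ ∏ j, gen j ^ v j = m) :
    ∃ d : ℕ, 0 < d ∧ ∃ N : ℕ, ∀ n, N ≤ n →
      (traceFiltration 𝒜 f w).ideal n ≤
        (traceFiltration 𝒜 f w).ideal d * (traceFiltration 𝒜 f w).ideal (n - d) := by
  obtain ⟨d, hd, N, hpeel⟩ := exists_peel δM wt
  refine ⟨d, hd, N, fun n hn x hx => ?_⟩
  -- Step 1: `x ∈ 𝒥_n ⊆ ⟨G n⟩`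
  have h1 : (x : B) ∈ AddSubgroup.closure (genSet 𝒜 gen wt n) := by
    have hle : (weightedFiltration f w).ideal n ≤ genIdeal (wt := wt) hcl n := by
      rw [weightedFiltration_ideal, Ideal.span_le]
      intro m hm
      obtain ⟨v, hv, rfl⟩ := hwm n m hm
      have := mul_mono_mem_genSet (𝒜 := 𝒜) (gen := gen) (wt := wt) (SetLike.one_mem_graded 𝒜) hv
      rw [one_mul] at this
      exact AddSubgroup.subset_closure this
    exact hle ((mem_traceFiltration_iff 𝒜 f w).mp hx)
  -- Step 2: project to degree `0`
  have h2 : (x : B) ∈ AddSubgroup.closure (kerGenSet 𝒜 gen δM wt n) :=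
    mem_closure_kerGenSet δM hgen h1 x.2
  -- Step 3: every kernel generator of weight `≥ n ≥ N` peels into `K_d · K_{n-d}`
  suffices key : ∀ y ∈ AddSubgroup.closure (kerGenSet 𝒜 gen δM wt n),
      ∃ z ∈ (traceFiltration 𝒜 f w).ideal d * (traceFiltration 𝒜 f w).ideal (n - d), (z : B) = y by
    obtain ⟨z, hz, hzx⟩ := key x h2
    rwa [← Subtype.ext hzx]
  intro y hy
  induction hy using AddSubgroup.closure_induction with
  | mem y hy =>
    obtain ⟨b, hb, v, hv, hker, rfl⟩ := hy
    obtain ⟨u₁, u₂, rfl, hu₁, hu₂, hwt₁⟩ := hpeel v hker (hn.trans hv)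
    have hm₁ : ∏ j, gen j ^ u₁ j ∈ 𝒜 0 := hu₁ ▸ mono_mem_graded 𝒜 gen δM hgen u₁
    have hm₂ : ∏ j, gen j ^ u₂ j ∈ 𝒜 0 := hu₂ ▸ mono_mem_graded 𝒜 gen δM hgen u₂
    have hK₁ : (⟨_, hm₁⟩ : ↥(𝒜 0)) ∈ (traceFiltration 𝒜 f w).ideal d := by
      rw [mem_traceFiltration_iff, ← hwt₁]
      exact hmono u₁
    have hK₂ : (⟨_, hm₂⟩ : ↥(𝒜 0)) ∈ (traceFiltration 𝒜 f w).ideal (n - d) := by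
      rw [mem_traceFiltration_iff]
      refine (weightedFiltration f w).antitone ?_ (hmono u₂)
      have : ∑ j, (u₁ + u₂) j * wt j = ∑ j, u₁ j * wt j + ∑ j, u₂ j * wt j := wdeg_add wt u₁ u₂
      omega
    refine ⟨⟨b, hb⟩ * (⟨_, hm₁⟩ * ⟨_, hm₂⟩), Ideal.mul_mem_left _ _ (Ideal.mul_mem_mul hK₁ hK₂), ?_⟩
    rw [mono_add]
    rfl
  | zero => exact ⟨0, zero_mem _, rfl⟩
  | add z z' _ _ hz hz' =>
    obtain ⟨a, ha, rfl⟩ := hz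
    obtain ⟨a', ha', rfl⟩ := hz'
    exact ⟨a + a', add_mem ha ha', rfl⟩
  | neg z _ hz =>
    obtain ⟨a, ha, rfl⟩ := hz
    exact ⟨-a, neg_mem ha, rfl⟩

end Trace

/-! ## §5 (G1a) for the homogeneous centre: the theorem -/

section Main

open CoarseChart

/-- **(G1a) VERONESE NORMALISATION holds**: for a ring graded by an additive commutative group, finitely generated
over its degree-`0` part, and a homogeneous weighted centre, the degree-`0` trace of the weighted filtration has a
Veronese degree. [OURS · L1 W4.5c] — NOT a statement of the manuscript. -/
theorem veroneseNormalisation : VeroneseNormalisation := by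
  intro ι _ _ B _ 𝒜 _ hT2 c f δ w hf
  classical
  obtain ⟨t, ht⟩ := hT2
  -- homogeneous generators: the homogeneous components of the elements of `t`, and the centre
  let S : Finset B := t.biUnion fun x => ((DirectSum.decompose 𝒜 x).support).image
    fun i => (DirectSum.decompose 𝒜 x i : B)
  have hShom : ∀ y ∈ S, ∃ i, y ∈ 𝒜 i := by
    intro y hy
    obtain ⟨x, -, hy⟩ := Finset.mem_biUnion.mp hy
    obtain ⟨i, -, rfl⟩ := Finset.mem_image.mp hy
    exact ⟨i, (DirectSum.decompose 𝒜 x i).2⟩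
  choose dS hdS using hShom
  let M := ↥S ⊕ Fin c
  let gen : M → B := Sum.elim (fun y => (y : B)) f
  let δM : M → ι := Sum.elim (fun y => dS y y.2) δ
  let wt : M → ℕ := Sum.elim (fun _ => 0) w
  have hgen : ∀ j, gen j ∈ 𝒜 (δM j) := by
    rintro (y | i)
    · exact hdS y y.2
    · exact hf i
  -- generation
  have hcl : Subring.closure (((𝒜 0 : AddSubgroup B) : Set B) ∪ Set.range gen) = ⊤ := by
    refine top_le_iff.mp (ht ▸ Subring.closure_le.mpr ?_)
    rintro x (hx | hx)
    · exact Subring.subset_closure (Or.inl hx)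
    · -- `x ∈ t` is the sum of its homogeneous components, all in `S ⊆ range gen`
      rw [← DirectSum.sum_support_decompose 𝒜 x]
      refine Subring.sum_mem _ fun i hi => Subring.subset_closure (Or.inr ?_)
      have hmem : (DirectSum.decompose 𝒜 x i : B) ∈ S :=
        Finset.mem_biUnion.mpr ⟨x, hx, Finset.mem_image.mpr ⟨i, hi, rfl⟩⟩
      exact ⟨Sum.inl ⟨_, hmem⟩, rfl⟩
  -- monomials: weights and membership in the weighted filtration
  have hsplit : ∀ v : M → ℕ, ∏ j, gen j ^ v j =
      (∏ y : ↥S, (y : B) ^ v (Sum.inl y)) * ∏ i, f i ^ v (Sum.inr i) := by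
    intro v; exact Fintype.prod_sum_type _
  have hwt : ∀ v : M → ℕ, ∑ j, v j * wt j = ∑ i, v (Sum.inr i) * w i := by
    intro v
    rw [Fintype.sum_sum_type]
    simp [wt]
  have hfmono : ∀ α : Fin c → ℕ, ∏ i, f i ^ α i ∈ weightedMonomials f w (∑ i, α i * w i) := by
    intro α
    refine ⟨Finsupp.equivFunOnFinite.symm α, ?_, ?_⟩
    · rw [Finsupp.weight_apply, Finsupp.sum_fintype _ _ (fun i => by simp)]
      simp
    · rw [Finsupp.prod_fintype _ _ (fun i => pow_zero _)]
      simp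
  have hmono : ∀ v : M → ℕ, ∏ j, gen j ^ v j ∈ (weightedFiltration f w).ideal (∑ j, v j * wt j) := by
    intro v
    rw [hsplit, hwt, weightedFiltration_ideal]
    exact Ideal.mul_mem_left _ _ (Ideal.subset_span (hfmono _))
  have hwm : ∀ n, ∀ m ∈ weightedMonomials f w n, ∃ v : M → ℕ, n ≤ ∑ j, v j * wt j ∧ ∏ j, gen j ^ v j = m := by
    rintro n m ⟨α, hα, rfl⟩
    refine ⟨Sum.elim (fun _ => 0) α, ?_, ?_⟩
    · rw [hwt]
      rw [Finsupp.weight_apply, Finsupp.sum_fintype _ _ (fun i => by simp)] at hα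
      simpa using hα
    · rw [hsplit, Finsupp.prod_fintype _ _ (fun i => pow_zero _)]
      simp
  obtain ⟨d, hd, N, hpeel⟩ := traceFiltration_peel 𝒜 f w gen δM wt hgen hcl hmono hwm
  obtain ⟨e, he, hver⟩ := idealFiltration_exists_veronese_of_peel (traceFiltration 𝒜 f w) hd hpeel
  exact ⟨e, he, hver⟩

end Main

end Summit.ResolutionOfSingularities.ResolutionOfSingularities.Theorems.WildQuotientResolution.S1.Veronese

end
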